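import Summits.NavierStokesRegularity.FluidComputer.GateBudgetDLedger
import HarnessLib

/-!
# GateBudget part 84 — the rung clock: the fine pulse clock and the cold half re-read (§245–§247)

Cell `pub-fluidc`, blueprint seat bp1 (gen 37, third item: THE CLOCK, SPEC-INPUT-bp1 §BN(4));
namespace `Summit.NavierStokesRegularity.FluidComputer.GateBudget`, headline member
`RotorKnob.rotorCircuit K K¹⁰ ε ρ` of the two-scale family from `delayInit` (5.6), `K ≥ 16`, on
the lattice window `200ε/K²⁰ ≤ ρ² ≤ 2ε/K¹⁰`, `ε² ≤ 1/(6K²⁰)`, `ε = kK¹⁰ρ²`; modes `0 = a`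
(carrier), `1 = b` (clock), `2 = c` (trigger), `3 = d` (transfer), `4 = ã` (output).
HONEST FRAMING: a low prior, high value-of-information experiment on Tao's machine paradigm;
NOT a claim that NS blows up.

WHAT. The clean ladder's clock window `(N - 1)·286/K⁹ ≤ 0.144` (parts 63/82/83) charges each
rung `286/K⁹ = 243/K⁹` (pulse: part 61 §188, the radius `√(b² + c²)` is `(ε + σ)`-Lipschitz,
read over part 55's CRUDE pulse length `242/K⁹`) `+ 43/K⁹` (cold phase: part 62 §193). Both
are bookkeeping, not dynamics. This file removes the first: §245 `knob_pulse_clock_fine` is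
part 61 §188 with a free pulse length `τ` (`b(r) - ((ε + σ)τ + c(T')) ≤ -b(T') ≤ b(r) + ((ε +
σ)τ + c(r))`), and over part 80's exported FINE pulse length `T' - r ≤ 241 log K/K¹⁰` the exit
ratio obeys `|θ₁ - θ| ≤ 242 log K/K¹⁰` (§245 numerics) — `41.9/K⁹` at `K = 16` instead of
`243/K⁹`, and `o(1/K⁹)`. §246 `knob_pulse_half_clock` = part 80 §236's rung restricted to its
pulse exit `T'` (everything part 80 says at `T'`: the two pulse lengths, live trigger, dousing
`c(T') ≤ 2ρ²/K¹⁰`, misfire pin, output floor and ceiling, transfer ledger) WITH the fine exit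
ratio and the trigger floor `(ρ²/K⁹)e^{-485K} ≤ c(T')` (part 61 §189) re-exported. §247
`knob_cold_half_clock` re-reads the cold phase from ANY dousing state `T' ≥ 0` (`b(T') = -θ₁ε`,
`1.249 ≤ θ₁ ≤ 3/2`, `P(T') ≤ 1/50`, `c(T') ≤ 2ρ²/K¹⁰`, trigger floor, `ã(T') ≥ 0`): part 60
§186's relight `tz < r' < T' + 3`, part 62 §192–§194's clock ledger in the exit ratio's own
currency `b(r') = θ'ε`, `θ' ≤ 1.41422`, `θ₁ - 43/K⁹ ≤ θ' ∨ 1.39999 ≤ θ'`, the duration `r' -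
T' ≥ 9/4`, part 77 §229's damping POINTWISE on `[T', r']` (`|d| ≤ |d(T')| + 3/K⁹`) and at `r'`
(`|d(r')| ≤ |d(T')|e^{-(9/4)Kã(T')} + 3/K⁹`), part 80 §235's output growth, and the SHARP cold
pair law `|P(r') - P(T')| ≤ 6(|d(T')| + 3/K⁹)/K⁹` (part 56 `knob_pair_dose` with the pointwise
`d`-bound as the dose level instead of `|d| ≤ 1`).
WHY TWO HALVES. Part 80 exports its cold phase only through `T' + 1 ≤ tz < r' < T' + 3` and the
crude clock disjunction; the brackets part 62 needs are internal to part 66. Re-running part 60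
at the same `T'` gives a relight `r'` with the brackets but no exported uniqueness, so every
cold-phase fact is re-derived at THAT `r'`; and the one hypothesis the cold half needs that part
80 does not export, `P(T') ≤ 1/50`, is exactly what the two-sided climb (part 82 §239
`pulse_pslip`) supplies from its budget — so the halves are glued in the ladder (part 85), not
here.
HONEST LIMITS. (i) the cold `43/K⁹` stays: part 60's carrier slopes `1 - P₀ ∓ (8, 6)/K⁹` are
hard-wired one level down (parts 59/60); with this file's pointwise cold `d`-bound the pair dose
is `6(|d(T')| + 3/K⁹)/K⁹ = O(1/K¹³)` on the ladder, so a re-run of parts 59/60 with the pair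
variation as a parameter would shrink it — recorded, not done; (ii) the true relight ratio
DRIFTS UP (`θ'² = θ₁² + 2sΛ/K¹⁰`, `Λ = log(c(r')/c(T')) ≥ log(K/2)`) and clips at `√(2(1 -
P₀))`; the ledger only bounds the loss; (iii) `242 log K/K¹⁰ ≤ 242/K⁹` always, `≤ 1/K⁹` only
for `K ≥ 2200` or so; (iv) `∃`, no uniqueness of `T'`, `tz`, `r'`; (v) nothing about
Navier–Stokes.
[cite: Tao2016AveragedNS, §5.5 Theorem 5.3, (5.5), (5.6), (b-eq), (c-eq), (d-eq), (ta-eq),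
(energy-con), (est)]
-/

noncomputable section

namespace Summit.NavierStokesRegularity.FluidComputer.GateBudget

open Real Set
open Literature.Analysis.FluidPDE.Tao2016AveragedNS

variable {K ε ρ : ℝ} {X : ℝ → Fin 5 → ℝ} {C : ℝ → ℝ}

/-! ## §245 The fine pulse clock -/

/-- §245 NUMERICS (`K ≥ 16`, `0 < ε`, `0 < ρ`, `K¹⁰ρ² ≤ 2ε`): `(ε + ρ²e^{-K¹⁰})·(241 log
K/K¹⁰) + ρ²/K⁹ + 2ρ²/K¹⁰ ≤ (242 log K/K¹⁰)ε`, `ρ² ≤ ε`, `242 log K/K¹⁰ ≤ 242/K⁹`. [folklore] -/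
theorem pulse_clock_fine_numerics (hK : 16 ≤ K) (hε : 0 < ε) (hρ : 0 < ρ)
    (hhi : K ^ 10 * ρ ^ 2 ≤ 2 * ε) :
    (ε + ρ ^ 2 * exp (-K ^ 10)) * (241 * log K / K ^ 10) + ρ ^ 2 / K ^ 9 + 2 * ρ ^ 2 / K ^ 10
        ≤ 242 * log K / K ^ 10 * ε ∧ ρ ^ 2 ≤ ε ∧ 242 * log K / K ^ 10 ≤ 242 / K ^ 9 := by
  have hK0 : (0 : ℝ) < K := by linarith
  have hK9 : (0 : ℝ) < K ^ 9 := by positivity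
  have hK10 : (0 : ℝ) < K ^ 10 := by positivity
  have h169 : (16 : ℝ) ^ 9 ≤ K ^ 9 := pow_le_pow_left₀ (by norm_num) hK 9
  have hlog : log K ≤ K := by linarith only [Real.log_le_sub_one_of_pos hK0]
  have hlog0 : 0 ≤ log K := Real.log_nonneg (by linarith)
  have hlog1 : 1 ≤ log K := by
    have h1 : exp 1 ≤ K := by have := Real.exp_one_lt_d9; linarith
    have h2 := Real.log_le_log (Real.exp_pos 1) h1
    rwa [Real.log_exp] at h2
  have he1 : exp (-K ^ 10) ≤ 1 := Real.exp_le_one_iff.2 (by linarith only [hK10])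
  have hσ1 : ρ ^ 2 * exp (-K ^ 10) ≤ ρ ^ 2 := mul_le_of_le_one_right (sq_nonneg ρ) he1
  have h3 : K * ρ ^ 2 * K ^ 9 ≤ 2 * ε := by
    have e : K * ρ ^ 2 * K ^ 9 = K ^ 10 * ρ ^ 2 := by ring
    rw [e]; exact hhi
  have hKρ : 0 ≤ K * ρ ^ 2 := by positivity
  have h4 : 244 * (K * ρ ^ 2) ≤ ε := by
    have := mul_le_mul_of_nonneg_left h169 hKρ
    nlinarith only [this, h3, hε, hKρ]
  refine ⟨?_, ?_, ?_⟩
  · have h1 : ρ ^ 2 * exp (-K ^ 10) * (241 * log K) ≤ ρ ^ 2 * (241 * log K) :=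
      mul_le_mul_of_nonneg_right hσ1 (by positivity)
    have h2 : ρ ^ 2 * (241 * log K) ≤ ρ ^ 2 * (241 * K) :=
      mul_le_mul_of_nonneg_left (by linarith only [hlog]) (sq_nonneg ρ)
    have h5 : 2 * ρ ^ 2 ≤ 2 * (K * ρ ^ 2) := by nlinarith only [sq_nonneg ρ, hK]
    have h6 : ε ≤ ε * log K := le_mul_of_one_le_right hε.le hlog1
    have key : (ε + ρ ^ 2 * exp (-K ^ 10)) * (241 * log K) + K * ρ ^ 2 + 2 * ρ ^ 2
        ≤ 242 * log K * ε := by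
      nlinarith only [h1, h2, h4, h5, h6]
    have e : (ε + ρ ^ 2 * exp (-K ^ 10)) * (241 * log K / K ^ 10) + ρ ^ 2 / K ^ 9
        + 2 * ρ ^ 2 / K ^ 10
        = ((ε + ρ ^ 2 * exp (-K ^ 10)) * (241 * log K) + K * ρ ^ 2 + 2 * ρ ^ 2) / K ^ 10 := by
      field_simp
    have e2 : 242 * log K / K ^ 10 * ε = 242 * log K * ε / K ^ 10 := by ring
    rw [e, e2]
    exact div_le_div_of_nonneg_right key hK10.le
  · nlinarith only [h4, hKρ, hK, sq_nonneg ρ]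
  · rw [div_le_div_iff₀ hK10 hK9]
    have := mul_le_mul_of_nonneg_right hlog hK9.le
    have e : K * K ^ 9 = K ^ 10 := by ring
    nlinarith only [this, e, hlog0]

/-- §245 **THE FINE PULSE CLOCK** (part 61 §188 with a free pulse length). Headline member from
(5.6), `K ≥ 16`, `0 < ε`, `0 < ρ`; any `0 ≤ r ≤ T'` with `T' - r ≤ τ`, entered at `b(r) ≥ 0`,
left at `b(T') ≤ 0`. THEN `b(r) - ((ε + ρ²e^{-K¹⁰})τ + c(T')) ≤ -b(T') ≤ b(r) + ((ε +
ρ²e^{-K¹⁰})τ + c(r))` (part 53 §157: `√(b² + c²)` is `(ε + σ)`-Lipschitz; `|b| ≤ √(b² + c²) ≤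
|b| + c`). [cite: Tao2016AveragedNS, §5.5 (5.5), (5.6), (b-eq), (c-eq)] -/
theorem knob_pulse_clock_fine
    (hX : ∀ t, HasDerivAt X (RotorKnob.rotorCircuit K (K ^ 10) ε ρ (X t)) t)
    (h0 : X 0 = delayInit) (hε : 0 < ε) (hρ : 0 < ρ) {r T' τ : ℝ} (hr : 0 ≤ r)
    (hrT : r ≤ T') (hT' : T' - r ≤ τ) (hbr : 0 ≤ X r 1) (hbT : X T' 1 ≤ 0) :
    X r 1 - ((ε + ρ ^ 2 * exp (-K ^ 10)) * τ + X T' 2) ≤ -X T' 1 ∧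
      -X T' 1 ≤ X r 1 + ((ε + ρ ^ 2 * exp (-K ^ 10)) * τ + X r 2) := by
  have hXf := hX
  rw [RotorKnob.rotorCircuit_eq_fiveGate] at hXf
  have hσ : (0 : ℝ) ≤ ρ ^ 2 * exp (-K ^ 10) := by positivity
  obtain ⟨hup, hdn⟩ := radius_sqrt_lipschitz hXf h0 hε.le hσ hr (right_mem_Icc.2 hrT)
  have hcr0 : 0 ≤ X r 2 := c_nonneg hXf h0 hσ hr
  have hcT0 : 0 ≤ X T' 2 := c_nonneg hXf h0 hσ (hr.trans hrT)
  have hlip : (ε + ρ ^ 2 * exp (-K ^ 10)) * (T' - r) ≤ (ε + ρ ^ 2 * exp (-K ^ 10)) * τ :=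
    mul_le_mul_of_nonneg_left hT' (by positivity)
  have hRr : √(X r 1 ^ 2 + X r 2 ^ 2) ≤ X r 1 + X r 2 :=
    Real.sqrt_le_iff.2 ⟨by positivity, by nlinarith only [mul_nonneg hbr hcr0]⟩
  have hbRr : X r 1 ≤ √(X r 1 ^ 2 + X r 2 ^ 2) :=
    Real.le_sqrt_of_sq_le (by nlinarith only [sq_nonneg (X r 2)])
  have hRT : √(X T' 1 ^ 2 + X T' 2 ^ 2) ≤ -X T' 1 + X T' 2 :=
    Real.sqrt_le_iff.2 ⟨by linarith, by nlinarith only [mul_nonneg (neg_nonneg.2 hbT) hcT0]⟩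
  have hbRT : -X T' 1 ≤ √(X T' 1 ^ 2 + X T' 2 ^ 2) :=
    Real.le_sqrt_of_sq_le (by nlinarith only [sq_nonneg (X T' 2)])
  constructor
  · linarith only [hbRr, hdn, hlip, hRT]
  · linarith only [hbRT, hup, hlip, hRr]

/-! ## §246 The pulse half of a clean rung, with the fine clock and the trigger floor -/

/-- §246 **THE PULSE HALF WITH THE FINE CLOCK** (headline member from `delayInit` with a trigger
primitive `C`, part 80 §236's hypotheses verbatim: `K ≥ 16`, `0 < ε`, `ε² ≤ 1/(6K²⁰)`, `0 <
ρ`, `200ε/K²⁰ ≤ ρ²`, `K¹⁰ρ² ≤ 2ε`, `ε = kK¹⁰ρ²`; ignition `r ≥ 0`, `b(r) = θε`, `5/4 ≤ θ ≤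
29/20`, `c(r) = ρ²/K⁹`, `P(r) + 0.3η′ + 6/K⁹ ≤ 1/50`). THEN at part 80's pulse exit `T'`:
`r < T'`, `T' - r ≤ 242/K⁹`, `T' - r ≤ 241 log K/K¹⁰`, `c > 0` on `[r, T']`, `b(T') =
-θ₁ε` with the FINE ratio `|θ₁ - θ| ≤ 242 log K/K¹⁰`, `(ρ²/K⁹)e^{-485K} ≤ c(T') ≤ 2ρ²/K¹⁰`,
the misfire pin, `0 ≤ ã(T') ≤ ã(r) + K·(241 log K/K¹⁰)`, `ã(r) + 1/K⁹ ≤ ã(T') ≤ ã(r) + (7/2 +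
k²/3 + (2 log k + 520 log K)d(r)²)/K⁹`, `|d(T')| ≤ |d(r)| + (5k + (k/2 + 4)Kã(T'))/K¹⁰`.
[derived: part 80 §236, §245, part 61 §189] -/
theorem knob_pulse_half_clock
    (hX : ∀ t, HasDerivAt X (RotorKnob.rotorCircuit K (K ^ 10) ε ρ (X t)) t)
    (h0 : X 0 = delayInit) (hC : ∀ t, HasDerivAt C (X t 2) t) (hK : 16 ≤ K)
    (hε : 0 < ε) (hεK : ε ^ 2 ≤ 1 / (6 * K ^ 20)) (hρ : 0 < ρ)
    (hlo : 200 * ε / K ^ 20 ≤ ρ ^ 2) (hhi : K ^ 10 * ρ ^ 2 ≤ 2 * ε) (k : ℕ)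
    (hk : ε = k * K ^ 10 * ρ ^ 2) {r θ : ℝ} (hr : 0 ≤ r) (hθ1 : 5 / 4 ≤ θ)
    (hθ2 : θ ≤ 29 / 20) (hbr : X r 1 = θ * ε) (hcr : X r 2 = ρ ^ 2 / K ^ 9)
    (hPr : X r 3 ^ 2 + X r 4 ^ 2
      + 3 * (k * π / ((25 / 16 - 1 / 10 ^ 6) * K ^ 10 - 1) + 1 / K ^ 19
        + 310 * log K / K ^ 9) / 10 + 6 / K ^ 9 ≤ 1 / 50) :
    ∃ T' θ₁ : ℝ,
      r < T' ∧ T' - r ≤ 242 / K ^ 9 ∧ T' - r ≤ 241 * log K / K ^ 10 ∧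
      (∀ t ∈ Icc r T', 0 < X t 2) ∧ X T' 1 = -(θ₁ * ε) ∧
      θ - 242 * log K / K ^ 10 ≤ θ₁ ∧ θ₁ ≤ θ + 242 * log K / K ^ 10 ∧
      ρ ^ 2 / K ^ 9 * exp (-(485 * K)) ≤ X T' 2 ∧ X T' 2 ≤ 2 * ρ ^ 2 / K ^ 10 ∧
      |(C T' - C r) / ρ ^ 2 - k * π|
        ≤ k * π / ((25 / 16 - 1 / 10 ^ 6) * K ^ 10 - 1) + 1 / K ^ 19 ∧
      0 ≤ X T' 4 ∧ X T' 4 ≤ X r 4 + K * (241 * log K / K ^ 10) ∧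
      X r 4 + 1 / K ^ 9 ≤ X T' 4 ∧
      X T' 4 ≤ X r 4 + (7 / 2 + k ^ 2 / 3 + (2 * log k + 520 * log K) * X r 3 ^ 2) / K ^ 9 ∧
      |X T' 3| ≤ |X r 3| + (5 * k + (k / 2 + 4) * (K * X T' 4)) / K ^ 10 := by
  have hK0 : (0 : ℝ) < K := by linarith
  have hK1 : (1 : ℝ) ≤ K := by linarith
  obtain ⟨-, -, -, -, -, h243⟩ := leak_numerics hK hε hρ hlo k hk
  obtain ⟨hN, hρε, -⟩ := pulse_clock_fine_numerics hK hε hρ hhi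
  -- (1) part 80's rung, keeping its pulse-exit facts only
  obtain ⟨T', θ₁, -, -, -, ⟨hrT, hτ, hτf, hcpos, hbT, hθ₁lo, -, hcT, hpin, he0, hecr⟩, -, -,
      hfl, hceil, hdT, -, -, -, -⟩ :=
    knob_rung_ledger hX h0 hC hK hε hεK hρ hlo hhi k hk hr hθ1 hθ2 hbr hcr hPr
  -- (2) the fine clock (§245) over the fine pulse length
  have hbr0 : 0 ≤ X r 1 := by rw [hbr]; positivity
  have hθ₁0 : 0 ≤ θ₁ := by linarith only [hθ₁lo, hθ1, h243]
  have hbT0 : X T' 1 ≤ 0 := by rw [hbT]; nlinarith only [hθ₁0, hε]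
  obtain ⟨hlo2, hhi2⟩ := knob_pulse_clock_fine hX h0 hε hρ hr hrT.le hτf hbr0 hbT0
  rw [hbr, hbT, neg_neg] at hlo2 hhi2
  rw [hcr] at hhi2
  have h9 : (0 : ℝ) ≤ ρ ^ 2 / K ^ 9 := by positivity
  have h10 : (0 : ℝ) ≤ 2 * ρ ^ 2 / K ^ 10 := by positivity
  have hfine_lo : θ - 242 * log K / K ^ 10 ≤ θ₁ := by
    have h1 : (θ - 242 * log K / K ^ 10) * ε ≤ θ₁ * ε := by
      have e : (θ - 242 * log K / K ^ 10) * ε = θ * ε - 242 * log K / K ^ 10 * ε := by ring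
      rw [e]; linarith only [hlo2, hN, hcT, h9]
    exact le_of_mul_le_mul_right h1 hε
  have hfine_hi : θ₁ ≤ θ + 242 * log K / K ^ 10 := by
    have h1 : θ₁ * ε ≤ (θ + 242 * log K / K ^ 10) * ε := by
      have e : (θ + 242 * log K / K ^ 10) * ε = θ * ε + 242 * log K / K ^ 10 * ε := by ring
      rw [e]; linarith only [hhi2, hN, h10]
    exact le_of_mul_le_mul_right h1 hε
  -- (3) the trigger floor (part 61 §189) from the entry radius `≤ 2ε`
  have hRr : X r 1 ^ 2 + X r 2 ^ 2 ≤ 4 * ε ^ 2 := by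
    rw [hbr, hcr]
    have hc1 : ρ ^ 2 / K ^ 9 ≤ ε := (div_le_self (sq_nonneg ρ) (one_le_pow₀ hK1)).trans hρε
    have hθsq : (θ * ε) ^ 2 ≤ (3 / 2) ^ 2 * ε ^ 2 := by
      rw [mul_pow]
      exact mul_le_mul_of_nonneg_right
        (pow_le_pow_left₀ (by linarith only [hθ1]) (by linarith only [hθ2]) 2) (sq_nonneg ε)
    have hc2 : (ρ ^ 2 / K ^ 9) ^ 2 ≤ ε ^ 2 := pow_le_pow_left₀ h9 hc1 2
    linarith only [hθsq, hc2, sq_nonneg ε]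
  have hfloor := knob_pulse_trigger_floor hX h0 hK hε hρε hr hrT.le hτ hRr
    (by rw [hcr]; positivity)
  rw [hcr] at hfloor
  exact ⟨T', θ₁, hrT, hτ, hτf, hcpos, hbT, hfine_lo, hfine_hi, hfloor, hcT, hpin, he0, hecr, hfl,
    hceil, hdT⟩

/-! ## §247 The cold half of a clean rung, re-read from a dousing state -/

/-- §247 **THE COLD HALF, RE-READ** (headline member from `delayInit`, `K ≥ 16`, `0 < ε`, `ε²
≤ 1/(6K²⁰)`, `0 < ρ`, `K¹⁰ρ² ≤ 2ε`; a dousing state `T' ≥ 0`: `b(T') = -θ₁ε`, `1.249 ≤ θ₁ ≤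
3/2`, `P(T') ≤ 1/50`, `(ρ²/K⁹)e^{-485K} ≤ c(T') ≤ 2ρ²/K¹⁰`, `ã(T') ≥ 0`). THEN there are
`tz < r'` with `T' + 1 ≤ tz`, `b(tz) = 0`, `r' < T' + 3`, `c ≤ ρ²/K⁹` on `[T', r']`, `c(r') =
ρ²/K⁹` (part 60 §186); the relight ratio `b(r') = θ'ε` has `θ' ≤ 1.41422` and `θ₁ - 43/K⁹ ≤
θ' ∨ 1.39999 ≤ θ'` (part 62 §192–§194 in the exit ratio's currency); the SHARP cold pair law
`|P(r') - P(T')| ≤ 6(|d(T')| + 3/K⁹)/K⁹`; `r' - T' ≥ 9/4`; `|d(r')| ≤ |d(T')|e^{-(9/4)Kã(T')}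
+ 3/K⁹`; `ã(T') ≤ ã(r') ≤ ã(T') + 3K(|d(T')| + 3/K⁹)²`; and POINTWISE `|d| ≤ |d(T')| + 3/K⁹`
on `[T', r']`. [derived: part 60 §186, part 62 §191–§194, part 73 `clock_charge_le`, part 77
§229, part 80 §235, part 56 `knob_pair_dose`] -/
theorem knob_cold_half_clock
    (hX : ∀ t, HasDerivAt X (RotorKnob.rotorCircuit K (K ^ 10) ε ρ (X t)) t)
    (h0 : X 0 = delayInit) (hK : 16 ≤ K) (hε : 0 < ε) (hεK : ε ^ 2 ≤ 1 / (6 * K ^ 20))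
    (hρ : 0 < ρ) (hhi : K ^ 10 * ρ ^ 2 ≤ 2 * ε) {T' θ₁ : ℝ} (hT'0 : 0 ≤ T')
    (hθ1 : 1249 / 1000 ≤ θ₁) (hθ2 : θ₁ ≤ 3 / 2) (hbT : X T' 1 = -(θ₁ * ε))
    (hP : X T' 3 ^ 2 + X T' 4 ^ 2 ≤ 1 / 50) (hℓ : ρ ^ 2 / K ^ 9 * exp (-(485 * K)) ≤ X T' 2)
    (hcT : X T' 2 ≤ 2 * ρ ^ 2 / K ^ 10) (he0 : 0 ≤ X T' 4) :
    ∃ tz r' θ' : ℝ,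
      (T' + 1 ≤ tz ∧ X tz 1 = 0 ∧ tz < r' ∧ r' < T' + 3 ∧
        (∀ t ∈ Icc T' r', X t 2 ≤ ρ ^ 2 / K ^ 9) ∧ X r' 2 = ρ ^ 2 / K ^ 9) ∧
      (X r' 1 = θ' * ε ∧ θ' ≤ 141422 / 100000 ∧
        (θ₁ - 43 / K ^ 9 ≤ θ' ∨ 139999 / 100000 ≤ θ') ∧
        |X r' 3 ^ 2 + X r' 4 ^ 2 - (X T' 3 ^ 2 + X T' 4 ^ 2)|
          ≤ 6 * (|X T' 3| + 3 / K ^ 9) / K ^ 9) ∧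
      (9 / 4 ≤ r' - T' ∧
        |X r' 3| ≤ |X T' 3| * exp (-(9 / 4 * (K * X T' 4))) + 3 / K ^ 9 ∧
        X T' 4 ≤ X r' 4 ∧ X r' 4 ≤ X T' 4 + 3 * K * (|X T' 3| + 3 / K ^ 9) ^ 2 ∧
        ∀ t ∈ Icc T' r', |X t 3| ≤ |X T' 3| + 3 / K ^ 9) := by
  have hK0 : (0 : ℝ) < K := by linarith
  have hK9 : (0 : ℝ) < K ^ 9 := by positivity
  have h169 : (16 : ℝ) ^ 9 ≤ K ^ 9 := pow_le_pow_left₀ (by norm_num) hK 9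
  have h43 : (43 : ℝ) / K ^ 9 ≤ 1 / 10 ^ 3 := by
    rw [div_le_div_iff₀ hK9 (by norm_num)]; linarith only [h169]
  have hθ₁1 : 1 ≤ θ₁ := by linarith only [hθ1]
  have hL0 : (0 : ℝ) ≤ 485 * K := by positivity
  obtain ⟨P₀, hP₀⟩ : ∃ P₀ : ℝ, P₀ = X T' 3 ^ 2 + X T' 4 ^ 2 := ⟨_, rfl⟩
  have hP'0 : 0 ≤ P₀ := by rw [hP₀]; positivity
  have hP'50 : P₀ ≤ 1 / 50 := by rw [hP₀]; exact hP
  -- (1) the relight (part 60 §186) with the floor `L = 485K`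
  obtain ⟨tz, r', ⟨htz1, htz2, hbtz⟩, ⟨htzr, hr'3⟩, hcwin, hcr', hlow, ⟨hup1, hup2⟩, hclo, hchi⟩ :=
    knob_relight hX h0 hK hε hεK hρ hhi hT'0 hθ₁1 hθ2 hbT hP₀.symm hP'50 hcT hL0 hℓ
  obtain ⟨-, -, hsu1, hsu2, -, -, -, -⟩ := ledger_slopes hK hP'0 hP'50
  have hsu0 : 0 < 1 - P₀ + 6 / K ^ 9 := by linarith only [hsu1]
  have htz1' : T' + 1 ≤ tz := by
    have h1 : 1 ≤ θ₁ / (1 - P₀ + 6 / K ^ 9) := by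
      rw [le_div_iff₀ hsu0]; linarith only [hsu2, hθ1]
    linarith only [h1, htz1]
  have hT'r' : T' ≤ r' := by linarith only [htz1', htzr]
  -- (2) the clock ledger (part 62 §192–§194) for `x = b(r')/ε`, in the exit ratio's currency
  obtain ⟨x, hx_def⟩ : ∃ x : ℝ, x = X r' 1 / ε := ⟨_, rfl⟩
  have hxe : X r' 1 = x * ε := by rw [hx_def]; field_simp
  have hxlo : (1 - P₀ - 8 / K ^ 9) * (r' - tz) ≤ x := by
    rw [hx_def, le_div_iff₀ hε]; linarith only [hclo]
  have hxhi : x ≤ (1 - P₀ + 6 / K ^ 9) * (r' - tz) := by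
    rw [hx_def, div_le_iff₀ hε]; linarith only [hchi]
  obtain ⟨hxpos, hlower⟩ := theta_ledger_lower hK hP'0 hP'50 hθ2 htz2 htzr hlow hxlo
  obtain ⟨-, hupper⟩ :=
    theta_ledger_upper hK hP'0 hP'50 hθ₁1 hθ2 hL0 le_rfl htz1 htzr hup1 hup2 hxpos.le hxhi
  have hloθ : θ₁ + 243 / K ^ 9 - 243 / K ^ 9 ≤ θ₁ := by linarith only []
  obtain ⟨hwin1, hwin2⟩ := theta_window_step hK hP'0 hP'50 hloθ hxpos hupper hlower
  have hwin2' : θ₁ - 43 / K ^ 9 ≤ x ∨ 139999 / 100000 ≤ x := by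
    rcases hwin2 with h | h
    · left
      have e : θ₁ + 243 / K ^ 9 - 286 / K ^ 9 = θ₁ - 43 / K ^ 9 := by ring
      linarith only [h, e]
    · right; exact h
  -- (3) the duration from the clock charge `b' ≤ ε` (part 73)
  have hdur : 9 / 4 ≤ r' - T' := by
    have hch := clock_charge_le hX h0 hε.le (by positivity : (0 : ℝ) ≤ K ^ 10) hT'r'
    rw [hxe, hbT] at hch
    have hsum : 9 / 4 ≤ x + θ₁ := by
      rcases hwin2' with h | h <;> linarith only [h, hθ1, h43]
    have h2 : ε * (9 / 4) ≤ ε * (r' - T') := by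
      have := mul_le_mul_of_nonneg_left hsum hε.le
      linarith only [this, hch]
    exact le_of_mul_le_mul_left h2 hε
  -- (4) the transfer mode, pointwise on the cold phase (part 77 §229) and at the relight
  have hKe : 0 ≤ K * X T' 4 := mul_nonneg hK0.le he0
  have hdpt : ∀ t ∈ Icc T' r', |X t 3| ≤ |X T' 3| + 3 / K ^ 9 := by
    intro t ht
    have hct : ∀ s ∈ Icc T' t, X s 2 ≤ ρ ^ 2 / K ^ 9 :=
      fun s hs => hcwin s ⟨hs.1, hs.2.trans ht.2⟩
    have h := knob_cold_transfer hX h0 hK hT'0 ht.1 (by linarith only [ht.2, hr'3]) hct hρ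
    have hq : exp (-(K * X T' 4 * (t - T'))) ≤ 1 := by
      rw [Real.exp_le_one_iff]
      have := mul_nonneg hKe (sub_nonneg.2 ht.1)
      linarith only [this]
    have := mul_le_of_le_one_right (abs_nonneg (X T' 3)) hq
    linarith only [h, this]
  have hcoldT := knob_cold_transfer hX h0 hK hT'0 hT'r' hr'3.le hcwin hρ
  have hdcold : |X r' 3| ≤ |X T' 3| * exp (-(9 / 4 * (K * X T' 4))) + 3 / K ^ 9 := by
    have hexp : exp (-(K * X T' 4 * (r' - T'))) ≤ exp (-(9 / 4 * (K * X T' 4))) :=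
      exp_le_exp.2 (by nlinarith only [hKe, hdur])
    have := mul_le_mul_of_nonneg_left hexp (abs_nonneg (X T' 3))
    linarith only [hcoldT, this]
  -- (5) the sharp cold pair law (part 56 `knob_pair_dose` at dose level `|d(T')| + 3/K⁹`)
  have hdose := knob_pair_dose hX h0 hT'0 hcwin hdpt (right_mem_Icc.2 hT'r')
  have hpair : |X r' 3 ^ 2 + X r' 4 ^ 2 - (X T' 3 ^ 2 + X T' 4 ^ 2)|
      ≤ 6 * (|X T' 3| + 3 / K ^ 9) / K ^ 9 := by
    refine hdose.trans ?_
    have e : 2 * (ρ ^ 2)⁻¹ * (ρ ^ 2 / K ^ 9) * (|X T' 3| + 3 / K ^ 9) * (r' - T')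
        = 2 * (r' - T') * (|X T' 3| + 3 / K ^ 9) / K ^ 9 := by
      field_simp
    rw [e, div_le_div_iff_of_pos_right hK9]
    have hD0 : 0 ≤ |X T' 3| + 3 / K ^ 9 := by positivity
    nlinarith only [hr'3, hD0]
  -- (6) the output: monotone, and the cold growth (part 80 §235)
  have hmono := RotorKnob.rotorCircuit_output_monotone hK0.le hX
  have hegrow := cold_output_growth hX h0 hK hT'0 hT'r' hr'3.le hcwin hρ
  exact ⟨tz, r', x, ⟨htz1', hbtz, htzr, hr'3, hcwin, hcr'⟩, ⟨hxe, hwin1, hwin2', hpair⟩,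
    ⟨hdur, hdcold, hmono hT'r', hegrow, hdpt⟩⟩

end Summit.NavierStokesRegularity.FluidComputer.GateBudget

end
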